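import Summits.KontsevichZagierPeriods.KontsevichZagierPeriods.Theorems.LinRedNormalFormArrangementNormalFormStubRebaseSimplePosOneFibreParOne
import Summits.KontsevichZagierPeriods.KontsevichZagierPeriods.Theorems.LinRedNormalFormArrangementNormalFormStubRebaseSimplePosOneFibreDouble

/-!
# Stub `stub_rebaseSimplePosOneZero` (crux `ArrangementNormalForm`, line `janus-bands`, v10) —
part `OneZeroOfDouble`: the stub modulo the double-corner bands

`rebaseSimplePosOneZero_of_double'`: EXACTLY the signature of the registered stub
`stub_rebaseSimplePosOneZero` (`GS 1 1 → closure (GG 1 2 1 ∪ JJ 1 2 ∪ JD 2)` modulo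
`KZ.relations`: rebase with a simple base pole over a base of dimension `2` with one fibre)
PLUS ONLY the two double-corner hypotheses `Hdthick₁`, `Hdfar₁` of
`rebaseSimplePos_oneFibre_of_double'` specialised to `b = 0` (bands above their apex level
`κ`, `u − κ = A (v − u)`, `A > 0`, `κ` free of `y`, whose closed base polygon contains a corner
point `κ = u = v = 0` on the pole line `y = ℓ₂(x)`; worker W9's part). The residual hypothesis
`Hpar` (parallel transverse bounds) is DISCHARGED at `B = 1` by `rebaseSimplePos_par_one`
(product-cell dissection + level splits on pinching cells + the unfold–exchange chain on
non-pinching cells), inside the narrow target `closure (GG 1 2 1)`, which is embedded into the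
stub's target by monotonicity of the generated subgroup.

References: M. Kontsevich, D. Zagier, *Periods* (2001), §1.2.
-/

noncomputable section

open Set MeasureTheory MvPolynomial
open Literature.NumberTheory.Transcendental Literature.ModelTheory.ExponentialFields

namespace Summit.KontsevichZagierPeriods.ArrangementNormalForm.JanusBands

/-- **The one-fibre rebase over a base of dimension `2`, from the DOUBLE-corner bands only**
(`rebaseSimplePos_oneFibre_of_double` at `B = 1` with its hypothesis `Hpar` discharged by
`rebaseSimplePos_par_one`): for literal one-fibre data over a bounded polygonal base cell in
`(x, y)` (any bounds, any letter, exponents `n₁ = 0`, `n₂ = 1`), IF the double-corner bands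
(`Hdthick₁`, `Hdfar₁`: bands above their apex level with a corner point `κ = u = v = 0` of the
closed base polygon ON the pole line) are congruent to the subgroup generated by `GG 1 2 1`,
THEN so is `[s]`. -/
theorem rebaseSimplePos_oneFibre_of_double_one (m m' : ℕ) (s : KZ.IntegralRep (1 + 1 + 1)) (M : Fin m' → (Fin (1 + 1) → ℚ) × ℚ) (L : Fin m → (Fin 1 → ℚ) × ℚ) (e : Fin m → ℕ) (p : MvPolynomial (Fin 1) ℚ) (ℓ₁ ℓ₂ : (Fin 1 → ℚ) × ℚ) (a : Fin 1 → Option ((Fin (1 + 1) → ℚ) × ℚ)) (lo hi : Fin 1 → Fin 1 ⊕ ((Fin (1 + 1) → ℚ) × ℚ)) (hbd : Bornology.IsBounded s.domain) (hdom : s.domain = SeparatePos.gDom 1 1 m' M lo hi) (hint : Set.EqOn s.integrand (RebasePos.glit 1 1 p L e ℓ₁ ℓ₂ 0 1 a) s.domain) (Hdthick₁ : ∀ (m : ℕ) (L : Fin m → (Fin 1 → ℚ) × ℚ) (e : Fin m → ℕ) (ℓ₁ ℓ₂ : (Fin 1 → ℚ) × ℚ), ∀ (m' : ℕ) (s : KZ.IntegralRep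 (1 + 1 + 1)) (M : Fin m' → (Fin (1 + 1) → ℚ) × ℚ) (p : MvPolynomial (Fin 1) ℚ) (u v κ : (Fin (1 + 1) → ℚ) × ℚ) (A : ℚ), Bornology.IsBounded s.domain → s.domain = SeparatePos.gDom 1 1 m' M (fun _ => Sum.inr u) (fun _ => Sum.inr v) → Set.EqOn s.integrand (RebasePos.glit 1 1 p L e ℓ₁ ℓ₂ 0 1 (fun _ => some 0)) s.domain → κ.1 (Fin.last 1) = 0 → u - κ = A • (v - u) → 0 < A → (∀ z : Fin (1 + 1 + 1) → ℝ, (∀ j, 0 < SeparatePos.affF 1 1 (M j) z) → SeparatePos.affF 1 1 κ z < 0 ∧ 0 < SeparatePos.affF 1 1 u z ∧ SeparatePos.affF 1 1 u z < SeparatePos.affF 1 1 v z) → (∃ z ∈ closure {z : Fin (1 + 1 + 1) → ℝ | ∀ j, 0 < SeparatePos.affF 1 1 (M j) z}, SeparatePos.affF 1 1 κ z = 0 ∧ SeparatePos.affF 1 1 u z = 0 ∧ SeparatePos.affF 1 1 v z = 0 ∧ z (Fin.castAdd 1 (Fin.last 1)) = SeparatePos.affB 1 1 ℓ₂ z) →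 ∃ c ∈ AddSubgroup.closure (SeparatePos.GGset 1 2 1), KZ.of s - c ∈ KZ.relations) (Hdfar₁ : ∀ (m : ℕ) (L : Fin m → (Fin 1 → ℚ) × ℚ) (e : Fin m → ℕ) (ℓ₁ ℓ₂ : (Fin 1 → ℚ) × ℚ), ∀ (m' : ℕ) (s : KZ.IntegralRep (1 + 1 + 1)) (M : Fin m' → (Fin (1 + 1) → ℚ) × ℚ) (p : MvPolynomial (Fin 1) ℚ) (u v κ : (Fin (1 + 1) → ℚ) × ℚ) (A : ℚ), Bornology.IsBounded s.domain → s.domain = SeparatePos.gDom 1 1 m' M (fun _ => Sum.inr u) (fun _ => Sum.inr v) → Set.EqOn s.integrand (RebasePos.glit 1 1 p L e ℓ₁ ℓ₂ 0 1 (fun _ => some 0)) s.domain → κ.1 (Fin.last 1) = 0 → u - κ = A • (v - u) → 0 < A → (∀ z : Fin (1 + 1 + 1) → ℝ, (∀ j, 0 < SeparatePos.affF 1 1 (M j) z) → 0 < SeparatePos.affF 1 1 κ z ∧ SeparatePos.affF 1 1 u z < SeparatePos.affF 1 1 v z ∧ 2 * SeparatePos.affF 1 1 κ z ≤ SeparatePos.affF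 1 1 v z) → (∃ z ∈ closure {z : Fin (1 + 1 + 1) → ℝ | ∀ j, 0 < SeparatePos.affF 1 1 (M j) z}, SeparatePos.affF 1 1 κ z = 0 ∧ SeparatePos.affF 1 1 u z = 0 ∧ SeparatePos.affF 1 1 v z = 0 ∧ z (Fin.castAdd 1 (Fin.last 1)) = SeparatePos.affB 1 1 ℓ₂ z) → ∃ c ∈ AddSubgroup.closure (SeparatePos.GGset 1 2 1), KZ.of s - c ∈ KZ.relations) : ∃ c ∈ AddSubgroup.closure (SeparatePos.GGset 1 2 1), KZ.of s - c ∈ KZ.relations :=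
  rebaseSimplePos_oneFibre_of_double 1 m m' s M L e p ℓ₁ ℓ₂ a lo hi hbd hdom hint
    (fun ℓ _ => rebaseSimplePos_par_one m L e ℓ₁ ℓ) (fun ℓ _ => Hdthick₁ m L e ℓ₁ ℓ)
    (fun ℓ _ => Hdfar₁ m L e ℓ₁ ℓ)

/-- **The stub `stub_rebaseSimplePosOneZero` modulo the double-corner bands.** Exactly the
signature of the stub plus the hypotheses `Hdthick₁`, `Hdfar₁` (the texts of `Hdthick`, `Hdfar`
in `rebaseSimplePos_oneFibre_of_double'` at `b = 0`): `GS 1 1 → closure (GG 1 2 1 ∪ JJ 1 2 ∪ JD 2)`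
modulo `KZ.relations`. Proof: `rebaseSimplePos_oneFibre_of_double'` at `b = 0` with `Hpar`
discharged by `rebaseSimplePos_par_one`, and `closure (GG 1 2 1) ≤ closure (GG 1 2 1 ∪ JJ 1 2 ∪ JD 2)`. -/
theorem rebaseSimplePosOneZero_of_double' (GS : ℕ → ℕ → Set KZ.FormalRep) (GG : ℕ → ℕ → ℕ → Set KZ.FormalRep) (hGS : ∀ b k, GS b k = {w : KZ.FormalRep | ∃ (m m' n₁ n₂ : ℕ) (s : KZ.IntegralRep (b + 1 + k)) (M : Fin m' → (Fin (b + 1) → ℚ) × ℚ) (L : Fin m → (Fin b → ℚ) × ℚ) (e : Fin m → ℕ) (p : MvPolynomial (Fin b) ℚ) (ℓ₁ ℓ₂ : (Fin b → ℚ) × ℚ) (a : Fin k → Option ((Fin (b + 1) → ℚ) × ℚ)) (lo hi : Fin k → Fin k ⊕ ((Fin (b + 1) → ℚ) × ℚ)), (n₁ = 0 ∨ n₂ = 0) ∧ n₂ = 1 ∧ Bornology.IsBounded s.domain ∧ s.domain = {z | (∀ j, 0 < ∑ i, ((M j).1 i : ℝ) * z (Fin.castAdd k i) + ((M j).2 :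 ℝ)) ∧ ∀ i, Sum.elim (fun j => z (Fin.natAdd (b + 1) j)) (fun c => ∑ i', (c.1 i' : ℝ) * z (Fin.castAdd k i') + (c.2 : ℝ)) (lo i) < z (Fin.natAdd (b + 1) i) ∧ z (Fin.natAdd (b + 1) i) < Sum.elim (fun j => z (Fin.natAdd (b + 1) j)) (fun c => ∑ i', (c.1 i' : ℝ) * z (Fin.castAdd k i') + (c.2 : ℝ)) (hi i)} ∧ EqOn s.integrand (fun z => MvPolynomial.aeval (fun i => z (Fin.castAdd k (Fin.castSucc i))) p / (∏ j, (∑ i, ((L j).1 i : ℝ) * z (Fin.castAdd k (Fin.castSucc i)) + ((L j).2 : ℝ)) ^ e j) * ((z (Fin.castAdd k (Fin.last b)) - (∑ i, (ℓ₁.1 i : ℝ) * z (Fin.castAdd k (Fin.castSucc i)) + (ℓ₁.2 : ℝ))) ^ n₁ / (z (Fin.castAdd k (Fin.last b)) - (∑ i, (ℓ₂.1 i : ℝ) * z (Fin.castAdd k (Fin.castSucc i)) + (ℓ₂.2 : ℝ))) ^ n₂) * ∏ i, (a i).elim 1 (fun c => 1 / (z (Fin.natAdd (b + 1) i) - (∑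 i', (c.1 i' : ℝ) * z (Fin.castAdd k i') + (c.2 : ℝ))))) s.domain ∧ w = KZ.of s}) (hGG : ∀ b σ k, GG b σ k = {w : KZ.FormalRep | ∃ (m m' n₁ n₂ : ℕ) (s : KZ.IntegralRep (b + 1 + k)) (M : Fin m' → (Fin (b + 1) → ℚ) × ℚ) (L : Fin m → (Fin b → ℚ) × ℚ) (e : Fin m → ℕ) (p : MvPolynomial (Fin b) ℚ) (ℓ₁ ℓ₂ : (Fin b → ℚ) × ℚ) (a : Fin k → Option ((Fin (b + 1) → ℚ) × ℚ)) (lo hi : Fin k → Fin k ⊕ ((Fin (b + 1) → ℚ) × ℚ)), (n₁ = 0 ∨ n₂ = 0) ∧ (σ = 2 → (∀ i c, a i = some c → c.1 (Fin.last b) = 0) ∧ (∀ i c, (lo i = Sum.inr c ∨ hi i = Sum.inr c) → (c.1 (Fin.last b) = 0 ∨ c = (Pi.single (Fin.last b) 1, 0)))) ∧ Bornology.IsBounded s.domain ∧ s.domain = {z | (∀ j, 0 < ∑ i, ((M j).1 i : ℝ) * z (Fin.castAdd k i) + ((M j).2 : ℝ)) ∧ ∀ i, Sum.elim (fun j =>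 z (Fin.natAdd (b + 1) j)) (fun c => ∑ i', (c.1 i' : ℝ) * z (Fin.castAdd k i') + (c.2 : ℝ)) (lo i) < z (Fin.natAdd (b + 1) i) ∧ z (Fin.natAdd (b + 1) i) < Sum.elim (fun j => z (Fin.natAdd (b + 1) j)) (fun c => ∑ i', (c.1 i' : ℝ) * z (Fin.castAdd k i') + (c.2 : ℝ)) (hi i)} ∧ EqOn s.integrand (fun z => MvPolynomial.aeval (fun i => z (Fin.castAdd k (Fin.castSucc i))) p / (∏ j, (∑ i, ((L j).1 i : ℝ) * z (Fin.castAdd k (Fin.castSucc i)) + ((L j).2 : ℝ)) ^ e j) * ((z (Fin.castAdd k (Fin.last b)) - (∑ i, (ℓ₁.1 i : ℝ) * z (Fin.castAdd k (Fin.castSucc i)) + (ℓ₁.2 : ℝ))) ^ n₁ / (z (Fin.castAdd k (Fin.last b)) - (∑ i, (ℓ₂.1 i : ℝ) * z (Fin.castAdd k (Fin.castSucc i)) + (ℓ₂.2 : ℝ))) ^ n₂) * ∏ i, (a i).elim 1 (fun c => 1 / (z (Fin.natAdd (b + 1) i) - (∑ i', (c.1 i' : ℝ) * z (Fin.castAdd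 k i') + (c.2 : ℝ))))) s.domain ∧ w = KZ.of s}) (JJ : ℕ → ℕ → Set KZ.FormalRep) (JD : ℕ → Set KZ.FormalRep) (hJJ : ∀ b k, JJ b k = {w : KZ.FormalRep | ∃ (m m' : ℕ) (s : KZ.IntegralRep (b + k)) (M : Fin m' → (Fin b → ℚ) × ℚ) (L : Fin m → (Fin b → ℚ) × ℚ) (e : Fin m → ℕ) (p : MvPolynomial (Fin b) ℚ) (a : Fin k → Option ((Fin b → ℚ) × ℚ)) (lo hi : Fin k → Fin k ⊕ ((Fin b → ℚ) × ℚ)), Bornology.IsBounded s.domain ∧ s.domain = {z | (∀ j, 0 < ∑ i, ((M j).1 i : ℝ) * z (Fin.castAdd k i) + ((M j).2 : ℝ)) ∧ ∀ i, Sum.elim (fun j => z (Fin.natAdd b j)) (fun c => ∑ i', (c.1 i' : ℝ) * z (Fin.castAdd k i') + (c.2 : ℝ)) (lo i) < z (Fin.natAdd b i) ∧ z (Fin.natAdd b i) < Sum.elim (fun j => z (Fin.natAdd b j)) (fun c => ∑ i', (c.1 i' : ℝ) * z (Fin.castAdd k i') + (c.2 : ℝ)) (hi i)} ∧ EqOn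 s.integrand (fun z => MvPolynomial.aeval (fun i => z (Fin.castAdd k i)) p / (∏ j, (∑ i, ((L j).1 i : ℝ) * z (Fin.castAdd k i) + ((L j).2 : ℝ)) ^ e j) * ∏ i, (a i).elim 1 (fun c => 1 / (z (Fin.natAdd b i) - (∑ i', (c.1 i' : ℝ) * z (Fin.castAdd k i') + (c.2 : ℝ))))) s.domain ∧ w = KZ.of s}) (hJD : ∀ N, JD N = {w : KZ.FormalRep | ∃ b' k', b' + k' = N ∧ w ∈ JJ b' k'}) (Hdthick₁ : ∀ (m : ℕ) (L : Fin m → (Fin 1 → ℚ) × ℚ) (e : Fin m → ℕ) (ℓ₁ ℓ₂ : (Fin 1 → ℚ) × ℚ), ∀ (m' : ℕ) (s : KZ.IntegralRep (1 + 1 + 1)) (M : Fin m' → (Fin (1 + 1) → ℚ) × ℚ) (p : MvPolynomial (Fin 1) ℚ) (u v κ : (Fin (1 + 1) → ℚ) × ℚ) (A : ℚ), Bornology.IsBounded s.domain → s.domain = SeparatePos.gDom 1 1 m' M (fun _ => Sum.inr u) (fun _ => Sum.inr v) → Set.EqOn s.integrand (RebasePos.glit 1 1 p L e ℓ₁ ℓ₂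 0 1 (fun _ => some 0)) s.domain → κ.1 (Fin.last 1) = 0 → u - κ = A • (v - u) → 0 < A → (∀ z : Fin (1 + 1 + 1) → ℝ, (∀ j, 0 < SeparatePos.affF 1 1 (M j) z) → SeparatePos.affF 1 1 κ z < 0 ∧ 0 < SeparatePos.affF 1 1 u z ∧ SeparatePos.affF 1 1 u z < SeparatePos.affF 1 1 v z) → (∃ z ∈ closure {z : Fin (1 + 1 + 1) → ℝ | ∀ j, 0 < SeparatePos.affF 1 1 (M j) z}, SeparatePos.affF 1 1 κ z = 0 ∧ SeparatePos.affF 1 1 u z = 0 ∧ SeparatePos.affF 1 1 v z = 0 ∧ z (Fin.castAdd 1 (Fin.last 1)) = SeparatePos.affB 1 1 ℓ₂ z) → ∃ c ∈ AddSubgroup.closure (SeparatePos.GGset 1 2 1), KZ.of s - c ∈ KZ.relations) (Hdfar₁ : ∀ (m : ℕ) (L : Fin m → (Fin 1 → ℚ) × ℚ) (e : Fin m → ℕ) (ℓ₁ ℓ₂ : (Fin 1 → ℚ) × ℚ), ∀ (m' : ℕ) (s : KZ.IntegralRep (1 + 1 + 1)) (M : Fin m' → (Fin (1 + 1) → ℚ)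 × ℚ) (p : MvPolynomial (Fin 1) ℚ) (u v κ : (Fin (1 + 1) → ℚ) × ℚ) (A : ℚ), Bornology.IsBounded s.domain → s.domain = SeparatePos.gDom 1 1 m' M (fun _ => Sum.inr u) (fun _ => Sum.inr v) → Set.EqOn s.integrand (RebasePos.glit 1 1 p L e ℓ₁ ℓ₂ 0 1 (fun _ => some 0)) s.domain → κ.1 (Fin.last 1) = 0 → u - κ = A • (v - u) → 0 < A → (∀ z : Fin (1 + 1 + 1) → ℝ, (∀ j, 0 < SeparatePos.affF 1 1 (M j) z) → 0 < SeparatePos.affF 1 1 κ z ∧ SeparatePos.affF 1 1 u z < SeparatePos.affF 1 1 v z ∧ 2 * SeparatePos.affF 1 1 κ z ≤ SeparatePos.affF 1 1 v z) → (∃ z ∈ closure {z : Fin (1 + 1 + 1) → ℝ | ∀ j, 0 < SeparatePos.affF 1 1 (M j) z}, SeparatePos.affF 1 1 κ z = 0 ∧ SeparatePos.affF 1 1 u z = 0 ∧ SeparatePos.affF 1 1 v z = 0 ∧ z (Fin.castAdd 1 (Fin.last 1)) = SeparatePos.affB 1 1 ℓ₂ z) → ∃ c ∈ AddSubgroup.closure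 (SeparatePos.GGset 1 2 1), KZ.of s - c ∈ KZ.relations) : ∀ x ∈ GS 1 1, ∃ c ∈ AddSubgroup.closure (GG 1 2 1 ∪ JJ 1 2 ∪ JD 2), x - c ∈ KZ.relations := by
  -- the widened parts `JJ 1 2`, `JD 2` of the target (and their texts) are not needed
  have _hJJ := hJJ
  have _hJD := hJD
  intro x hx
  obtain ⟨c, hc, hxc⟩ := rebaseSimplePos_oneFibre_of_double' GS GG hGS hGG 0
    (fun m L e ℓ₁ ℓ₂ m' s M p u v => rebaseSimplePos_par_one m L e ℓ₁ ℓ₂ m' s M p u v)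
    Hdthick₁ Hdfar₁ x hx
  exact ⟨c, AddSubgroup.closure_mono (subset_union_left.trans subset_union_left) hc, hxc⟩

end Summit.KontsevichZagierPeriods.ArrangementNormalForm.JanusBands
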